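import Summits.NavierStokesRegularity.NavierStokesRegularity.Theses.AxisymmetricExtremality
import Summits.NavierStokesRegularity.NavierStokesRegularity.Theorems.AxisymmetricExtremalityAxisymmetricKatoGlobalStubSeregin2020TypeIISwirlVanishes
import Literature.Analysis.FluidPDE.LocalLeraySolutions
import Summits.NavierStokesRegularity.NavierStokesRegularity.Theorems.AxisymmetricExtremalityAxisymmetricKatoGlobalStubSeregin2020TypeIILemma22GaussProfile
import HarnessLib

/-!
# Seregin 2020, Lemma 2.2: the inequality (2.12) is printed with the wrong sign — the rendered
# lemma with `∂ₜπ + (u + 2x'/|x'|²)·∇π - Δπ ≤ 0` (SUBsolutions) is false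

Helper toward the stub `stub_seregin2020TypeII` of the crux `AxisymmetricKatoGlobal` (= the named
fact `Literature.Analysis.FluidPDE.Seregin2020_axisymmetricSingularPoint_typeII`, G. Seregin,
Anal. Math. Phys. 10 (2020) Paper 46 = arXiv:2006.04140, Thm 2.1), whose one remaining unproved
ingredient in the tree is Lemma 2.2 (propagation of a lower bound from the axis, after
Nazarov–Uraltseva, St. Petersburg Math. J. 23 (2012), Lemma 4.2), kept as the written-out
hypothesis `hWH` of `ae_swirl_eq_zero_of_weakHarnack` / `blowupIndex_eq_top_of_weakHarnack`.

**Finding (sign audit).** The paper prints (2.12) as `∂ₜπ + (u + 2x'/|x'|²)·∇π - Δπ ≤ 0`, i.e. for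
SUBsolutions of the drift–heat operator, and `hWH` renders it verbatim
(`deriv … + fderiv … (U …) + 2/ϱ ∂_ϱ … - Δ … ≤ 0`). For subsolutions a lower bound does not
propagate from the axis: this file proves, kernel-checked, that the rendered `∀`-statement is
FALSE (`not_weakHarnack_subsolution`). Counterexample: `u = U = 0`, `p = 0`, `K = 0`, `S = ∅`,
`R = k = M = 1`, `N = 0`, and the time-independent profile
`Φ(t, x) = exp(-L(x₀² + x₁²))`, `L = 16(|log β| + 1)`: it is `C^∞`, `0 < Φ ≤ 1`, `Φ = 1` on the
axis, all derivative bounds of the class 𝒱 hold, and off the axis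
`∂ₜΦ + 0 + (2/ϱ)∂_ϱΦ - ΔΦ = -4L²ϱ² e^{-Lϱ²} ≤ 0` (for `Φ = h(ϱ²)` the operator is `-4ϱ²h''(ϱ²)`,
nonpositive for every convex `h`); yet `Φ < β` on the positive-measure part
`]-1/4, 0[ × B((3/8, 0, 0), 1/16)` of `Q(1/2)`, contradicting (2.15) "`Φ ≥ βk` a.e. on `Q(R/2)`".

**The intended statement** is for SUPERsolutions, `∂ₜπ + (u + 2x'/|x'|²)·∇π - Δπ ≥ 0` off the
axis: this is what Nazarov–Uraltseva's Lemma 4.2 assumes ("a Lipschitz nonnegative supersolution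
of (4.1)–(4.2) with `ε = +1`"), and what Seregin's own first proof line needs (the inequality
`∫(∂ₜπ η + ∇π·∇η - (u + 2x'/|x'|²)·∇η π) ≥ 4π₀ ∫ πη dx₃dt` for `η ≥ 0` is the weak form of
`∂ₜπ + b·∇π - Δπ ≥ 0` after `div b = 4π₀ δ_{axis}`). The consumer is unaffected by the flip: in
`ae_swirl_eq_zero_of_weakHarnack` the lemma is applied to `Φ = Γ₀ ∓ Γ`, which satisfy (2.11) with
EQUALITY off the axis (`affSwirl_classV_time`, fourth clause), so both `≤ 0` and `0 ≤` hold there.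
Corrected rendering: replace `… - (Laplacian.laplacian (Φ z.1)) z.2 ≤ 0` by
`0 ≤ … - (Laplacian.laplacian (Φ z.1)) z.2` in `hWH` (both files), and discharge it in the
consumer by `(h₄ z hz hρ).ge` instead of `(h₄ z hz hρ).le`.

Contents: `contDiff_gaussX` (smoothness of the profile; its calculus is the sibling
`…Lemma22GaussProfile`) and the refutation `not_weakHarnack_subsolution`, whose statement is the
NEGATION of the `hWH` binder of `ae_swirl_eq_zero_of_weakHarnack`, byte for byte. What is NOT
here: the corrected lemma (supersolutions) — its first pieces are the siblings `…Lemma22Energy*`.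

## References

* G. Seregin, Anal. Math. Phys. 10 (2020), Paper 46 = arXiv:2006.04140, Lemma 2.2, (2.12)–(2.15)
  and the first line of its proof (arXiv p. 8). [Seregin2020]
* A. I. Nazarov, N. N. Uraltseva, St. Petersburg Math. J. 23 (2012) 93–115 = arXiv:1011.1888,
  §4, (4.1)–(4.3), Remark 9, Lemma 4.2. [NazarovUraltseva2012]
-/

-- the problem directory repeats the summit name (D-0017); core's `dupNamespace` linter fires
set_option linter.dupNamespace false

noncomputable section

open MeasureTheory Set Function Filter Topology TopologicalSpace Metric WithLp
open scoped NNReal ENNReal Laplacian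

namespace Summit.NavierStokesRegularity.NavierStokesRegularity.Theorems.AxisymmetricKatoGlobal.EulerScaling

open Literature.Analysis.FluidPDE

/-! ### Smoothness of the profile -/

/-- The planar Gaussian is `C^∞` on `ℝ³`. [folklore] -/
theorem contDiff_gaussX (L : ℝ) {n : WithTop ℕ∞} :
    ContDiff ℝ n (fun y : EuclideanSpace ℝ (Fin 3) => Real.exp (-(L * (y 0 ^ 2 + y 1 ^ 2)))) := by
  have h0 : ContDiff ℝ n (fun y : EuclideanSpace ℝ (Fin 3) => y 0) :=
    (EuclideanSpace.proj (0 : Fin 3) : EuclideanSpace ℝ (Fin 3) →L[ℝ] ℝ).contDiff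
  have h1 : ContDiff ℝ n (fun y : EuclideanSpace ℝ (Fin 3) => y 1) :=
    (EuclideanSpace.proj (1 : Fin 3) : EuclideanSpace ℝ (Fin 3) →L[ℝ] ℝ).contDiff
  exact Real.contDiff_exp.comp (contDiff_const.mul ((h0.pow 2).add (h1.pow 2))).neg

/-! ### The refutation -/

/-- **Seregin 2020, Lemma 2.2 with (2.12) as printed (`≤ 0`, subsolutions) — in the rendered form
of the hypothesis `hWH` of `ae_swirl_eq_zero_of_weakHarnack` — is FALSE.** The statement negated
here is that binder byte for byte: "for all `M`, `N` there is `β > 0` such that for all data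
`(u, U, p, K, Φ, S, R, k)` with (𝒜), the drift representative `U`, the class-𝒱 clauses, `Φ ≥ 0`,
(2.12) `∂ₜΦ + DΦ[U] + (2/ϱ)∂_ϱΦ - ΔΦ ≤ 0` off the axis, `R, k > 0`, `M ≥ 1`, `N_R⁴ ≤ N`, (2.13),
(2.14): `Φ ≥ βk` a.e. on `Q(R/2)`". Witness against it (with `M = 1`, `N = 0` and the `β` they
produce): `u = U = 0`, `p = 0` (the trivial suitable weak solution, all scaled energies `0 = K`),
`S = ∅`, `R = k = 1`, `Φ(t, x) = exp(-L(x₀² + x₁²))` with `L = 16(|log β| + 1)` — smooth, time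
independent, `0 < Φ ≤ 1 = Mk`, `Φ = 1 = k` on the axis, derivative bounds `gaussX_deriv_bounds`,
subsolution by `gaussX_subsolution` —, while `Φ < β` on `]-1/4, 0[ × B((3/8,0,0), 1/16) ⊆ Q(1/2)`,
a set of positive measure. Hence the printed "`≤ 0`" in (2.12) is a misprint for "`≥ 0`"
(supersolutions, as in Nazarov–Uraltseva's Lemma 4.2 and as Seregin's proof uses); see the module
docstring for the corrected rendering.
[cite: Seregin2020, Lemma 2.2 (2.12)–(2.15) (arXiv p. 8); sign of (2.12) refuted as printed] -/
theorem not_weakHarnack_subsolution :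
    ¬ (∀ (M : ℝ) (N : ℝ≥0), ∃ β : ℝ, 0 < β ∧
        ∀ (u U : ℝ → EuclideanSpace ℝ (Fin 3) → EuclideanSpace ℝ (Fin 3))
          (p : ℝ → EuclideanSpace ℝ (Fin 3) → ℝ) (K : ℝ≥0)
          (Φ : ℝ → EuclideanSpace ℝ (Fin 3) → ℝ) (S : Set (ℝ × EuclideanSpace ℝ (Fin 3))) (R k : ℝ),
          (∀ s, IsAxisymmetric (u s)) → (∀ s, IsAxisymmetricScalar (p s)) →
          (∀ a : ℝ, 0 < a →
            IsSuitableWeakSolutionInBall a 0 u p ∧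
            cknAEss a 0 u ≤ K ∧
            cknC a 0 u ≤ K ∧
            cknD a 0 p ≤ K ∧
            ∃ G' : ℝ → EuclideanSpace ℝ (Fin 3) →
                EuclideanSpace ℝ (Fin 3) →L[ℝ] EuclideanSpace ℝ (Fin 3),
              HasWeakSpatialGradientOn (parabolicCylinderOpens (2 * a) 0) u G' ∧
                cknAEss a 0 u + cknE a 0 G' ≤ K) →
          uncurry u =ᵐ[volume.restrict {z : ℝ × EuclideanSpace ℝ (Fin 3) | z.1 < 0}] uncurry U →
          ContinuousOn (uncurry U)
            {z : ℝ × EuclideanSpace ℝ (Fin 3) | z.1 < 0 ∧ cylRadius z.2 ≠ 0} →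
          (∀ z : ℝ × EuclideanSpace ℝ (Fin 3), z.1 < 0 → cylRadius z.2 ≠ 0 →
            ContDiffAt ℝ (⊤ : ℕ∞) (U z.1) z.2) →
          ContinuousOn (fun z : ℝ × EuclideanSpace ℝ (Fin 3) => fderiv ℝ (U z.1) z.2)
            {z : ℝ × EuclideanSpace ℝ (Fin 3) | z.1 < 0 ∧ cylRadius z.2 ≠ 0} →
          IsClosed S → (∀ z ∈ S, z.1 ≤ 0 ∧ cylRadius z.2 = 0) → IsParabolicNull 1 S →
          ContinuousOn (uncurry Φ) ({z : ℝ × EuclideanSpace ℝ (Fin 3) | z.1 < 0} \ S) →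
          (∀ z : ℝ × EuclideanSpace ℝ (Fin 3), z.1 < 0 → z ∉ S →
            ContDiffAt ℝ (⊤ : ℕ∞) (Φ z.1) z.2) →
          ContinuousOn (fun z : ℝ × EuclideanSpace ℝ (Fin 3) => fderiv ℝ (Φ z.1) z.2)
            ({z : ℝ × EuclideanSpace ℝ (Fin 3) | z.1 < 0} \ S) →
          (∀ e : EuclideanSpace ℝ (Fin 3), ContinuousOn (fun z : ℝ × EuclideanSpace ℝ (Fin 3) =>
              fderiv ℝ (fun y => fderiv ℝ (Φ z.1) y e) z.2 e)
            ({z : ℝ × EuclideanSpace ℝ (Fin 3) | z.1 < 0} \ S)) →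
          (∀ z : ℝ × EuclideanSpace ℝ (Fin 3), z.1 < 0 → cylRadius z.2 ≠ 0 →
            DifferentiableAt ℝ (fun r => Φ r z.2) z.1) →
          ContinuousOn (fun z : ℝ × EuclideanSpace ℝ (Fin 3) => deriv (fun r => Φ r z.2) z.1)
            {z : ℝ × EuclideanSpace ℝ (Fin 3) | z.1 < 0 ∧ cylRadius z.2 ≠ 0} →
          (∀ δ ρ : ℝ, 0 < δ → δ < ρ → ∃ C : ℝ, ∀ z : ℝ × EuclideanSpace ℝ (Fin 3),
            z.1 ∈ Ioo (-ρ ^ 2) 0 → δ < cylRadius z.2 → cylRadius z.2 < ρ → |z.2 2| < ρ →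
              |deriv (fun r => Φ r z.2) z.1| ≤ C ∧ ‖fderiv ℝ (Φ z.1) z.2‖ ≤ C ∧
              ∀ e : EuclideanSpace ℝ (Fin 3), ‖e‖ ≤ 1 →
                |fderiv ℝ (fun y => fderiv ℝ (Φ z.1) y e) z.2 e| ≤ C) →
          (∃ B : ℝ, ∀ z : ℝ × EuclideanSpace ℝ (Fin 3), z.1 < 0 → z ∉ S → |Φ z.1 z.2| ≤ B) →
          (∀ z : ℝ × EuclideanSpace ℝ (Fin 3), z.1 < 0 → z ∉ S → 0 ≤ Φ z.1 z.2) →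
          (∀ z : ℝ × EuclideanSpace ℝ (Fin 3), z.1 < 0 → cylRadius z.2 ≠ 0 →
            deriv (fun r => Φ r z.2) z.1 + fderiv ℝ (Φ z.1) z.2 (U z.1 z.2) +
                2 / cylRadius z.2 * partialDeriv (eR z.2) (Φ z.1) z.2 - (Laplacian.laplacian (Φ z.1)) z.2 ≤ 0) →
          0 < R → 0 < k → 1 ≤ M →
          (∫⁻ s in Ioo (-R ^ 2) 0, (∫⁻ y in ball (0 : EuclideanSpace ℝ (Fin 3)) R,
              ‖u s y‖ₑ ^ (3 : ℕ)) ^ (4 / 3 : ℝ) ≤ (N : ℝ≥0∞) * ENNReal.ofReal R ^ 2) →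
          (∀ z : ℝ × EuclideanSpace ℝ (Fin 3), z.1 ∈ Ioo (-R ^ 2) 0 → cylRadius z.2 = 0 →
            z.2 2 ∈ Ioo (-(2 * R)) (2 * R) → z ∉ S → k ≤ Φ z.1 z.2) →
          (∀ z : ℝ × EuclideanSpace ℝ (Fin 3), z.1 ∈ Ioo (-R ^ 2) 0 →
            z.2 ∈ ball (0 : EuclideanSpace ℝ (Fin 3)) (2 * R) → z ∉ S → Φ z.1 z.2 ≤ M * k) →
          ∀ᵐ z ∂(volume.restrict (parabolicCylinder (R / 2) (0 : ℝ × EuclideanSpace ℝ (Fin 3)))),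
            β * k ≤ Φ z.1 z.2) := by
  intro h
  obtain ⟨β, hβ, hall⟩ := h 1 0
  -- the data: zero velocity and pressure, `S = ∅`, `R = k = 1`, and the Gaussian-in-`x'` profile
  set L : ℝ := 16 * (|Real.log β| + 1) with hL
  have hL0 : 0 < L := by positivity
  set Φ : ℝ → EuclideanSpace ℝ (Fin 3) → ℝ :=
    fun _ x => Real.exp (-(L * (x 0 ^ 2 + x 1 ^ 2))) with hΦ
  have hΦ1 : ∀ t x, Φ t x ≤ 1 := fun t x => gaussX_le_one hL0.le x
  have hΦpos : ∀ t x, 0 < Φ t x := fun t x => Real.exp_pos _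
  have hcd : ContDiff ℝ ((⊤ : ℕ∞) : WithTop ℕ∞)
      (fun y : EuclideanSpace ℝ (Fin 3) => Real.exp (-(L * (y 0 ^ 2 + y 1 ^ 2)))) := contDiff_gaussX L
  -- ### the hypotheses of the rendered lemma for these data
  have h1 : ∀ s : ℝ, IsAxisymmetric ((0 : ℝ → EuclideanSpace ℝ (Fin 3) → EuclideanSpace ℝ (Fin 3)) s) := by
    intro s θ x
    show (0 : EuclideanSpace ℝ (Fin 3)) = rotZ θ 0
    ext i
    fin_cases i <;> simp [rotZ]
  have h2 : ∀ s : ℝ, IsAxisymmetricScalar ((0 : ℝ → EuclideanSpace ℝ (Fin 3) → ℝ) s) := fun s θ x => rfl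
  have h3 : ∀ a : ℝ, 0 < a →
      IsSuitableWeakSolutionInBall a 0 (0 : ℝ → EuclideanSpace ℝ (Fin 3) → EuclideanSpace ℝ (Fin 3))
          (0 : ℝ → EuclideanSpace ℝ (Fin 3) → ℝ) ∧
        cknAEss a 0 (0 : ℝ → EuclideanSpace ℝ (Fin 3) → EuclideanSpace ℝ (Fin 3)) ≤ (0 : ℝ≥0) ∧
        cknC a 0 (0 : ℝ → EuclideanSpace ℝ (Fin 3) → EuclideanSpace ℝ (Fin 3)) ≤ (0 : ℝ≥0) ∧
        cknD a 0 (0 : ℝ → EuclideanSpace ℝ (Fin 3) → ℝ) ≤ (0 : ℝ≥0) ∧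
        ∃ G' : ℝ → EuclideanSpace ℝ (Fin 3) → EuclideanSpace ℝ (Fin 3) →L[ℝ] EuclideanSpace ℝ (Fin 3),
          HasWeakSpatialGradientOn (parabolicCylinderOpens (2 * a) 0)
              (0 : ℝ → EuclideanSpace ℝ (Fin 3) → EuclideanSpace ℝ (Fin 3)) G' ∧
            cknAEss a 0 (0 : ℝ → EuclideanSpace ℝ (Fin 3) → EuclideanSpace ℝ (Fin 3)) + cknE a 0 G' ≤
              (0 : ℝ≥0) := by
    intro a ha
    have hA : cknAEss a 0 (0 : ℝ → EuclideanSpace ℝ (Fin 3) → EuclideanSpace ℝ (Fin 3)) = 0 := by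
      refine le_antisymm ?_ (zero_le)
      unfold cknAEss
      refine essSup_le_of_ae_le 0 (ae_of_all _ fun t => ?_)
      simp
    have hC : cknC a 0 (0 : ℝ → EuclideanSpace ℝ (Fin 3) → EuclideanSpace ℝ (Fin 3)) = 0 := by
      simp [cknC]
    have hD : cknD a 0 (0 : ℝ → EuclideanSpace ℝ (Fin 3) → ℝ) = 0 := by
      simp [cknD, ENNReal.zero_rpow_of_pos (show (0 : ℝ) < 3 / 2 by norm_num)]
    have hEz : cknE a 0 (0 : ℝ → EuclideanSpace ℝ (Fin 3) → EuclideanSpace ℝ (Fin 3) →L[ℝ]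
        EuclideanSpace ℝ (Fin 3)) = 0 := by
      simp [cknE, frobeniusNormSq_zero]
    refine ⟨⟨isSuitableWeakSolutionOn_zero _ 1, ⟨0, ae_of_all _ fun t => by simp⟩,
      ⟨0, hasWeakSpatialGradientOn_zero _, by simp [frobeniusNormSq_zero]⟩, ?_⟩, hA.le, hC.le, hD.le,
      ⟨0, hasWeakSpatialGradientOn_zero _, by rw [hA, hEz]; simp⟩⟩
    rw [uncurry_zero]
    exact MemLp.zero
  have h5 : ContinuousOn (uncurry (0 : ℝ → EuclideanSpace ℝ (Fin 3) → EuclideanSpace ℝ (Fin 3)))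
      {z : ℝ × EuclideanSpace ℝ (Fin 3) | z.1 < 0 ∧ cylRadius z.2 ≠ 0} := by
    rw [uncurry_zero]
    exact continuousOn_const
  have h6 : ∀ z : ℝ × EuclideanSpace ℝ (Fin 3), z.1 < 0 → cylRadius z.2 ≠ 0 →
      ContDiffAt ℝ (⊤ : ℕ∞) ((0 : ℝ → EuclideanSpace ℝ (Fin 3) → EuclideanSpace ℝ (Fin 3)) z.1) z.2 :=
    fun z _ _ => by
      show ContDiffAt ℝ (⊤ : ℕ∞) (fun _ : EuclideanSpace ℝ (Fin 3) => (0 : EuclideanSpace ℝ (Fin 3))) z.2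
      exact contDiff_zero_fun.contDiffAt
  have h7 : ContinuousOn (fun z : ℝ × EuclideanSpace ℝ (Fin 3) =>
      fderiv ℝ ((0 : ℝ → EuclideanSpace ℝ (Fin 3) → EuclideanSpace ℝ (Fin 3)) z.1) z.2)
      {z : ℝ × EuclideanSpace ℝ (Fin 3) | z.1 < 0 ∧ cylRadius z.2 ≠ 0} := by
    have e : (fun z : ℝ × EuclideanSpace ℝ (Fin 3) =>
        fderiv ℝ ((0 : ℝ → EuclideanSpace ℝ (Fin 3) → EuclideanSpace ℝ (Fin 3)) z.1) z.2) = fun _ => 0 := by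
      funext z
      simp only [Pi.zero_apply]
      exact congrFun fderiv_zero z.2
    rw [e]
    exact continuousOn_const
  have h10 : IsParabolicNull 1 (∅ : Set (ℝ × EuclideanSpace ℝ (Fin 3))) := parabolicHausdorff_empty one_pos
  have h11 : ContinuousOn (uncurry Φ) ({z : ℝ × EuclideanSpace ℝ (Fin 3) | z.1 < 0} \ ∅) :=
    (hcd.continuous.comp continuous_snd).continuousOn
  have h12 : ∀ z : ℝ × EuclideanSpace ℝ (Fin 3), z.1 < 0 → z ∉ (∅ : Set (ℝ × EuclideanSpace ℝ (Fin 3))) →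
      ContDiffAt ℝ (⊤ : ℕ∞) (Φ z.1) z.2 := fun z _ _ => hcd.contDiffAt
  have hcd1 : ∀ e : EuclideanSpace ℝ (Fin 3), ContDiff ℝ ((⊤ : ℕ∞) : WithTop ℕ∞)
      (fun y : EuclideanSpace ℝ (Fin 3) => fderiv ℝ (fun y : EuclideanSpace ℝ (Fin 3) =>
        Real.exp (-(L * (y 0 ^ 2 + y 1 ^ 2)))) y e) := fun e =>
    (hcd.fderiv_right (m := ((⊤ : ℕ∞) : WithTop ℕ∞)) le_rfl).clm_apply contDiff_const
  have h13 : ContinuousOn (fun z : ℝ × EuclideanSpace ℝ (Fin 3) => fderiv ℝ (Φ z.1) z.2)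
      ({z : ℝ × EuclideanSpace ℝ (Fin 3) | z.1 < 0} \ ∅) :=
    ((hcd.continuous_fderiv (by simp)).comp continuous_snd).continuousOn
  have h14 : ∀ e : EuclideanSpace ℝ (Fin 3), ContinuousOn (fun z : ℝ × EuclideanSpace ℝ (Fin 3) =>
      fderiv ℝ (fun y => fderiv ℝ (Φ z.1) y e) z.2 e) ({z : ℝ × EuclideanSpace ℝ (Fin 3) | z.1 < 0} \ ∅) :=
    fun e => ((((hcd1 e).continuous_fderiv (by simp)).clm_apply continuous_const).comp
      continuous_snd).continuousOn
  have h15 : ∀ z : ℝ × EuclideanSpace ℝ (Fin 3), z.1 < 0 → cylRadius z.2 ≠ 0 →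
      DifferentiableAt ℝ (fun r => Φ r z.2) z.1 := fun z _ _ => differentiableAt_const _
  have hdt : ∀ z : ℝ × EuclideanSpace ℝ (Fin 3), deriv (fun r => Φ r z.2) z.1 = 0 := fun z => deriv_const _ _
  have h16 : ContinuousOn (fun z : ℝ × EuclideanSpace ℝ (Fin 3) => deriv (fun r => Φ r z.2) z.1)
      {z : ℝ × EuclideanSpace ℝ (Fin 3) | z.1 < 0 ∧ cylRadius z.2 ≠ 0} := by
    simp only [hdt]
    exact continuousOn_const
  have h17 : ∀ δ ρ : ℝ, 0 < δ → δ < ρ → ∃ C : ℝ, ∀ z : ℝ × EuclideanSpace ℝ (Fin 3),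
      z.1 ∈ Ioo (-ρ ^ 2) 0 → δ < cylRadius z.2 → cylRadius z.2 < ρ → |z.2 2| < ρ →
        |deriv (fun r => Φ r z.2) z.1| ≤ C ∧ ‖fderiv ℝ (Φ z.1) z.2‖ ≤ C ∧
        ∀ e : EuclideanSpace ℝ (Fin 3), ‖e‖ ≤ 1 →
          |fderiv ℝ (fun y => fderiv ℝ (Φ z.1) y e) z.2 e| ≤ C := by
    intro δ ρ hδ hδρ
    have hρ : 0 ≤ ρ := (hδ.trans hδρ).le
    refine ⟨16 * L ^ 2 * ρ ^ 2 + 4 * L + 4 * L * ρ, fun z _ _ hzρ _ => ?_⟩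
    obtain ⟨hb1, hb2⟩ := gaussX_deriv_bounds L ρ hL0.le hρ z.2 hzρ
    refine ⟨?_, ?_, fun e he => ?_⟩
    · rw [hdt, abs_zero]; positivity
    · exact hb1.trans (by nlinarith [sq_nonneg L, sq_nonneg ρ])
    · exact (hb2 e he).trans (by nlinarith)
  have h18 : ∃ B : ℝ, ∀ z : ℝ × EuclideanSpace ℝ (Fin 3), z.1 < 0 →
      z ∉ (∅ : Set (ℝ × EuclideanSpace ℝ (Fin 3))) → |Φ z.1 z.2| ≤ B :=
    ⟨1, fun z _ _ => by rw [abs_of_pos (hΦpos z.1 z.2)]; exact hΦ1 z.1 z.2⟩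
  have h20 : ∀ z : ℝ × EuclideanSpace ℝ (Fin 3), z.1 < 0 → cylRadius z.2 ≠ 0 →
      deriv (fun r => Φ r z.2) z.1 +
          fderiv ℝ (Φ z.1) z.2 ((0 : ℝ → EuclideanSpace ℝ (Fin 3) → EuclideanSpace ℝ (Fin 3)) z.1 z.2) +
          2 / cylRadius z.2 * partialDeriv (eR z.2) (Φ z.1) z.2 - (Laplacian.laplacian (Φ z.1)) z.2 ≤ 0 := by
    intro z _ hρ
    rw [hdt, zero_add]
    exact gaussX_subsolution L z.2 hρ
  have h22 : ∫⁻ s in Ioo (-(1 : ℝ) ^ 2) 0, (∫⁻ y in ball (0 : EuclideanSpace ℝ (Fin 3)) 1,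
      ‖(0 : ℝ → EuclideanSpace ℝ (Fin 3) → EuclideanSpace ℝ (Fin 3)) s y‖ₑ ^ (3 : ℕ)) ^ (4 / 3 : ℝ) ≤
        ((0 : ℝ≥0) : ℝ≥0∞) * ENNReal.ofReal 1 ^ 2 := by
    have e : (fun s : ℝ => (∫⁻ y in ball (0 : EuclideanSpace ℝ (Fin 3)) 1,
        ‖(0 : ℝ → EuclideanSpace ℝ (Fin 3) → EuclideanSpace ℝ (Fin 3)) s y‖ₑ ^ (3 : ℕ)) ^ (4 / 3 : ℝ)) =
        fun _ => 0 := by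
      funext s
      simp [ENNReal.zero_rpow_of_pos (show (0 : ℝ) < 4 / 3 by norm_num)]
    rw [e, lintegral_zero]
    exact zero_le
  have h23 : ∀ z : ℝ × EuclideanSpace ℝ (Fin 3), z.1 ∈ Ioo (-(1 : ℝ) ^ 2) 0 → cylRadius z.2 = 0 →
      z.2 2 ∈ Ioo (-(2 * (1 : ℝ))) (2 * 1) → z ∉ (∅ : Set (ℝ × EuclideanSpace ℝ (Fin 3))) →
        (1 : ℝ) ≤ Φ z.1 z.2 := by
    intro z _ hρ _ _
    obtain ⟨h0, h1⟩ := (cylRadius_eq_zero_iff z.2).1 hρ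
    show (1 : ℝ) ≤ Real.exp (-(L * (z.2 0 ^ 2 + z.2 1 ^ 2)))
    rw [h0, h1]
    simp
  have h24 : ∀ z : ℝ × EuclideanSpace ℝ (Fin 3), z.1 ∈ Ioo (-(1 : ℝ) ^ 2) 0 →
      z.2 ∈ ball (0 : EuclideanSpace ℝ (Fin 3)) (2 * 1) → z ∉ (∅ : Set (ℝ × EuclideanSpace ℝ (Fin 3))) →
        Φ z.1 z.2 ≤ 1 * 1 := fun z _ _ _ => (hΦ1 z.1 z.2).trans_eq (one_mul _).symm
  -- ### the conclusion of the rendered lemma for these data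
  have key := hall 0 0 0 0 Φ ∅ 1 1 h1 h2 h3 EventuallyEq.rfl h5 h6 h7 isClosed_empty
    (fun z hz => hz.elim) h10 h11 h12 h13 h14 h15 h16 h17 h18 (fun z _ _ => (hΦpos z.1 z.2).le) h20
    one_pos one_pos le_rfl h22 h23 h24
  -- ### … fails on the positive-measure set `]-1/4, 0[ × B(x⋆, 1/16)`, `x⋆ = (3/8, 0, 0)`
  set xs : EuclideanSpace ℝ (Fin 3) := EuclideanSpace.single (0 : Fin 3) (3 / 8 : ℝ) with hxs
  set A : Set (ℝ × EuclideanSpace ℝ (Fin 3)) := Ioo (-((1 : ℝ) / 2) ^ 2) 0 ×ˢ ball xs (1 / 16) with hA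
  have hAsub : A ⊆ parabolicCylinder (1 / 2) (0 : ℝ × EuclideanSpace ℝ (Fin 3)) := by
    intro z hz
    rw [mem_parabolicCylinder]
    simp only [Prod.fst_zero, Prod.snd_zero, zero_sub]
    refine ⟨hz.1, ?_⟩
    have h2 : dist z.2 xs < 1 / 16 := hz.2
    have hxs0 : dist xs 0 = 3 / 8 := by
      rw [dist_zero_right, hxs, EuclideanSpace.single, PiLp.norm_single, Real.norm_eq_abs]
      norm_num
    calc dist z.2 0 ≤ dist z.2 xs + dist xs 0 := dist_triangle _ _ _
      _ < 1 / 16 + 3 / 8 := by linarith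
      _ < 1 / 2 := by norm_num
  have hsmall : ∀ z ∈ A, Φ z.1 z.2 < β := by
    intro z hz
    have h2 : dist z.2 xs < 1 / 16 := hz.2
    have hc : |z.2 0 - 3 / 8| < 1 / 16 := by
      have hle : ‖(z.2 - xs) 0‖ ≤ ‖z.2 - xs‖ := PiLp.norm_apply_le (z.2 - xs) 0
      rw [dist_eq_norm] at h2
      have e : (z.2 - xs) 0 = z.2 0 - 3 / 8 := by simp [hxs]
      rw [e, Real.norm_eq_abs] at hle
      linarith
    have h0 : 5 / 16 < z.2 0 := by
      have := (abs_lt.1 hc).1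
      linarith
    have hq : 1 / 16 ≤ z.2 0 ^ 2 + z.2 1 ^ 2 := by nlinarith [sq_nonneg (z.2 1)]
    show Real.exp (-(L * (z.2 0 ^ 2 + z.2 1 ^ 2))) < β
    calc Real.exp (-(L * (z.2 0 ^ 2 + z.2 1 ^ 2))) ≤ Real.exp (-(|Real.log β| + 1)) := by
          rw [Real.exp_le_exp]
          have : L * (1 / 16) ≤ L * (z.2 0 ^ 2 + z.2 1 ^ 2) := mul_le_mul_of_nonneg_left hq hL0.le
          have hL16 : L * (1 / 16) = |Real.log β| + 1 := by rw [hL]; ring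
          linarith
      _ < Real.exp (Real.log β) := Real.exp_lt_exp.2 (by linarith [neg_abs_le (Real.log β)])
      _ = β := Real.exp_log hβ
  have hAmeas : MeasurableSet A := measurableSet_Ioo.prod measurableSet_ball
  have hApos : volume A ≠ 0 := by
    rw [hA, Measure.volume_eq_prod, Measure.prod_prod]
    refine mul_ne_zero ?_ (measure_ball_pos volume xs (by norm_num)).ne'
    rw [Real.volume_Ioo]
    norm_num
  have key' : ∀ᵐ z ∂(volume.restrict A), β * 1 ≤ Φ z.1 z.2 := ae_restrict_of_ae_restrict_of_subset hAsub key
  have hfalse : ∀ᵐ z ∂(volume.restrict A), False := by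
    filter_upwards [key', ae_restrict_mem hAmeas] with z hz1 hz2
    rw [mul_one] at hz1
    exact (not_lt.2 hz1) (hsmall z hz2)
  rw [eventually_false_iff_eq_bot, ae_eq_bot, Measure.restrict_eq_zero] at hfalse
  exact hApos hfalse

end Summit.NavierStokesRegularity.NavierStokesRegularity.Theorems.AxisymmetricKatoGlobal.EulerScaling

end
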